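import Mathlib.Analysis.SpecificLimits.Normed
import Literature.Barriers.ValiantsHypothesis.FullRankMultilinearFormulaLogProduct
import Literature.Barriers.ValiantsHypothesis.FullRankMultilinearTermRank
import Literature.Barriers.ValiantsHypothesis.FullRankMultilinearCutCounting
import HarnessLib

/-!
# Syntactically multilinear formulas of polynomial size do not compute full-rank polynomials
(Raz 2006, Cor. 3.6 — the polynomial-size form, for every field)

The assembly (roadmap step (a4)) of `FullRankMultilinearFormulaDecomposition/LogProduct.lean`
(log-products), `FullRankMultilinearProductRank.lean` / `…TermRank.lean` (rank of a log-product
term, union-bound step, rank exponent versus balance) and `FullRankMultilinearCutCounting.lean`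
(random balanced cuts are simultaneously unbalanced on disjoint sets):

* `not_isFullRank_of_syntMultilinear_core` — the argument with every numeric side condition
  explicit: `2(b+2)` levels of thresholds `m 4^{ℓ-1} > … > m`, `m 4^ℓ ≤ u`, `2D+1 ≤ m` where
  `|Φ| + 1 < 2^D`, and `(|Φ|+1) · 2u · (2D+1)^ℓ < (m+1)^{b+2}`;
* `not_isFullRank_of_syntMultilinear` — **for every `b` there is `n₀` such that for `u ≥ n₀` no
  syntactically multilinear formula (tree `WExpr`) of size `≤ u^b` in `2u` variables computes a
  full-rank polynomial** [Raz2006, Cor. 3.6: multilinear formulas for full-rank ("high rank")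
  polynomials have size `n^{Ω(log n)}`; here the weaker polynomial form, which is what the
  natural-proofs packaging of the `ValiantsHypothesis` tree consumes].

Proof (log-product form of [Raz2006, §3–§4]): if `g = Φ` were of full rank, then for every
balanced `Y` some term `T = g_T ∏_j A_j` of the iterated decomposition (`≤ |Φ|+1` terms) has
`rank M_Y(T) ≥ 2^u / 2^D`; by the term rank bound its rank exponent is `≥ u - D`, so `T` covers all
but `≤ 2D` variables (hence is FULL, every cofactor set having `≥ 2m - 2D ≥ m` elements) and every
cofactor set is `D`-balanced under `Y`; but for a fixed term the balanced `Y` doing this are at most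
`2u C(2u,u) ((2D+1)/√(m+1))^ℓ` — summing over the terms contradicts the last side condition.

## References
* [Raz2006] R. Raz, *Separation of multilinear circuit and formula size*, Theory of Computing 2
  (2006) 121–135, §3 (Lemma 3.3, Lemma 3.4, Cor. 3.6), §4.
-/

noncomputable section

namespace Literature.Barriers.ValiantsHypothesis.RazFormula

open MvPolynomial Finset Literature.Computability.AlgebraicComplexity
open Literature.Computability.AlgebraicComplexity.WExpr
open Literature.Barriers.ValiantsHypothesis.AKV (cm)

universe u v

/-! ### Geometric thresholds -/

/-- The thresholds `m 4^{ℓ-1}, m 4^{ℓ-2}, …, m`. [cite: Raz2006, §4] -/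
def geo (m : ℕ) : ℕ → List ℕ
  | 0 => []
  | n + 1 => (m * 4 ^ n) :: geo m n

/-- Unfolding. [cite: Raz2006, §4] -/
@[simp] theorem geo_zero (m : ℕ) : geo m 0 = [] := rfl
/-- Unfolding. [cite: Raz2006, §4] -/
@[simp] theorem geo_succ (m n : ℕ) : geo m (n + 1) = (m * 4 ^ n) :: geo m n := rfl

/-- `geo m ℓ` has `ℓ` thresholds. [cite: Raz2006, §4] -/
theorem length_geo (m : ℕ) : ∀ ℓ, (geo m ℓ).length = ℓ
  | 0 => rfl
  | n + 1 => by rw [geo_succ, List.length_cons, length_geo m n]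

/-- Every threshold is `≥ m`. [cite: Raz2006, §4] -/
theorem le_of_mem_geo {m : ℕ} : ∀ {ℓ t}, t ∈ geo m ℓ → m ≤ t
  | 0, t, h => by simp at h
  | n + 1, t, h => by
    rw [geo_succ, List.mem_cons] at h
    rcases h with rfl | h
    · exact Nat.le_mul_of_pos_right _ (by positivity)
    · exact le_of_mem_geo h

/-- The thresholds are admissible (`m ≥ 1`). [cite: Raz2006, §4] -/
theorem admissible_geo {m : ℕ} (hm : 1 ≤ m) : ∀ ℓ, Admissible (geo m ℓ)
  | 0 => trivial
  | 1 => by show 1 ≤ m * 4 ^ 0; simpa using hm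
  | n + 2 => by
    show 1 ≤ m * 4 ^ (n + 1) ∧ 2 * (m * 4 ^ n) ≤ m * 4 ^ (n + 1) ∧ Admissible (geo m (n + 1))
    refine ⟨le_trans hm (Nat.le_mul_of_pos_right _ (by positivity)), ?_, admissible_geo hm (n + 1)⟩
    have : m * 4 ^ (n + 1) = 4 * (m * 4 ^ n) := by ring
    omega

/-- The annulus lower bounds along `geo m ℓ`: the first is `p - 2 m 4^{ℓ-1}`, all others are
`≥ 2m`. [cite: Raz2006, §4] -/
theorem le_of_mem_lows_geo {m : ℕ} : ∀ {ℓ p L}, L ∈ lows p (geo m ℓ) →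
    L = p - 2 * (m * 4 ^ (ℓ - 1)) ∨ 2 * m ≤ L
  | 0, p, L, h => by simp [lows] at h
  | n + 1, p, L, h => by
    rw [geo_succ, lows, List.mem_cons] at h
    rcases h with rfl | h
    · left; simp
    · right
      rcases le_of_mem_lows_geo h with h' | h'
      · cases n with
        | zero => simp [lows] at h
        | succ n =>
          rw [Nat.add_sub_cancel] at h'
          have h1 : m * 4 ^ (n + 1) = 4 * (m * 4 ^ n) := by ring
          have h2 : m ≤ m * 4 ^ n := Nat.le_mul_of_pos_right _ (by positivity)
          omega
      · exact h'

/-! ### Small helpers -/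

/-- `∏_j 2^{f_j} = 2^{Σ_j f_j}` over a list. [folklore] -/
private theorem prod_map_two_pow {ι : Type*} (L : List ι) (f : ι → ℕ) :
    (L.map fun i => 2 ^ f i).prod = 2 ^ (L.map f).sum := by
  induction L with
  | nil => simp
  | cons a L ih => rw [List.map_cons, List.prod_cons, List.map_cons, List.sum_cons, pow_add, ih]

/-- `|Yᶜ ∩ X| = |X| - |Y ∩ X|`. [folklore] -/
private theorem card_compl_inter {α : Type*} [Fintype α] [DecidableEq α] (Y X : Finset α) :
    (Yᶜ ∩ X).card = X.card - (Y ∩ X).card := by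
  have h : (Y ∩ X).card + (Yᶜ ∩ X).card = X.card := by
    rw [← card_union_of_disjoint (disjoint_compl_right.mono inter_subset_left inter_subset_left)]
    congr 1; ext a; simp only [mem_union, mem_inter, mem_compl]; tauto
  omega

/-- From `|2y - x| ≤ 2D` (integers) to the real window `|y - x/2| ≤ D`. [folklore] -/
private theorem abs_sub_half_le {x y D : ℕ} (h : Int.natAbs (2 * (y : ℤ) - x) ≤ 2 * D) :
    |(y : ℝ) - (x : ℝ) / 2| ≤ D := by
  have h' : (2 : ℤ) * y - x ≤ 2 * D ∧ -(2 * (D : ℤ)) ≤ 2 * y - x := by omega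
  have h1 : (2 : ℝ) * y - x ≤ 2 * D := by exact_mod_cast h'.1
  have h2 : -(2 * (D : ℝ)) ≤ 2 * y - x := by exact_mod_cast h'.2
  rw [abs_le]
  constructor <;> linarith

/-! ### The core argument -/

variable {K : Type u} [Field K]

/-- **Core: no small syntactically multilinear formula computes a full-rank polynomial**, with all
numeric side conditions explicit (`ℓ = 2(b+2)` levels; see the module docstring).
[cite: Raz2006, Cor. 3.6 and Lemmas 3.3–3.4] -/
theorem not_isFullRank_of_syntMultilinear_core {u b m D : ℕ} (hm : 1 ≤ m)
    (hmu : m * 4 ^ (2 * (b + 2)) ≤ u) {e : WExpr K (Fin (2 * u))} (he : IsSyntMultilinear e)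
    (hD : e.size + 1 < 2 ^ D) (hmD : 2 * D + 1 ≤ m)
    (hfinal : ((e.size + 1 : ℕ) : ℝ) * (2 * u) * (2 * D + 1) ^ (2 * (b + 2)) < ((m : ℝ) + 1) ^ (b + 2)) :
    ¬ IsFullRank u e.eval := by
  classical
  set ℓ := 2 * (b + 2) with hℓ
  have hu : 1 ≤ u := le_trans (le_trans hm (Nat.le_mul_of_pos_right _ (by positivity))) hmu
  -- formulas missing a variable are not of full rank
  by_cases hvars : (varSet e).card < 2 * u
  · exact AKV.not_isFullRank_of_supported hu hvars (eval_mem_supported e)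
  have hcardE : (varSet e).card = 2 * u := by
    have := card_le_univ (varSet e); rw [Fintype.card_fin] at this; omega
  intro hfull
  -- thresholds and terms
  set ts := geo m ℓ with hts
  have hadm : Admissible ts := admissible_geo hm ℓ
  have hhead : ∀ t ∈ ts.head?, 2 * t < (varSet e).card := by
    intro t ht
    have hℓ1 : ℓ = (ℓ - 1) + 1 := by omega
    rw [hts, hℓ1, geo_succ, List.head?_cons, Option.mem_some_iff] at ht
    subst ht
    rw [hcardE]
    have : m * 4 ^ (ℓ - 1) * 4 = m * 4 ^ ℓ := by
      rw [mul_assoc, ← pow_succ, Nat.sub_add_cancel (by omega : 1 ≤ ℓ)]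
    omega
  set terms := decompIter ts e with hterms
  have hN : terms.length ≤ e.size + 1 := length_decompIter_le ts e
  -- the bad set of a term
  let Bad : (WExpr K (Fin (2 * u)) × List (MvPolynomial (Fin (2 * u)) K × Finset (Fin (2 * u)))) →
      Finset (Finset (Fin (2 * u))) := fun T =>
    (univ.powersetCard u).filter fun Y =>
      (∀ q ∈ T.2, |(((Y ∩ q.2).card : ℕ) : ℝ) - ((q.2.card : ℕ) : ℝ) / 2| ≤ D) ∧
        T.2.length = ℓ ∧ ∀ q ∈ T.2, m ≤ q.2.card
  -- (1) every balanced `Y` is bad for some term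
  have hcover : univ.powersetCard u ⊆ terms.toFinset.biUnion Bad := by
    intro Y hY
    have hYcard : Y.card = u := (mem_powersetCard.1 hY).2
    obtain ⟨T, hT, hrank⟩ :=
      AKV.exists_term_rank_ge terms termEval hfull (sum_decompIter ts e) Y hYcard
    obtain ⟨g, As⟩ := T
    obtain ⟨⟨hg, hgsub⟩, hAs, hpw, hcov, hdich⟩ :=
      decompIter_spec ts (2 * u) hadm he hhead hcardE.ge hT
    rw [hcardE] at hcov hdich
    -- rank bound of the term
    have hrk := AKV.rank_cm_mul_listProd_le Y Yᶜ (varSet g) (eval_mem_supported g) As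
      (fun q hq => (hAs q hq).1) (fun q hq => (hAs q hq).2.2) hpw
    change (cm (termEval (g, As)) Y Yᶜ).rank ≤ _ at hrk
    rw [prod_map_two_pow, ← pow_add] at hrk
    -- the exponent
    set x : Finset (Fin (2 * u)) → ℕ := fun X => X.card with hx
    set y : Finset (Fin (2 * u)) → ℕ := fun X => (Y ∩ X).card with hy
    set M : List (Finset (Fin (2 * u))) := varSet g :: As.map Prod.snd with hM
    have hEeq : min (Y ∩ varSet g).card (Yᶜ ∩ varSet g).card +
        (As.map fun q => min (Y ∩ q.2).card (Yᶜ ∩ q.2).card).sum =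
          (M.map fun X => min (y X) (x X - y X)).sum := by
      simp only [hM, List.map_cons, List.sum_cons, List.map_map, hx, hy, card_compl_inter]
      rfl
    have hcovM : (M.map x).sum ≤ 2 * u := by
      have : (M.map x).sum = (varSet g).card + (As.map fun q => q.2.card).sum := by
        simp only [hM, List.map_cons, List.sum_cons, List.map_map, hx]
        rfl
      rw [this]; exact hcov
    have hexp : u ≤ (M.map fun X => min (y X) (x X - y X)).sum + D := by
      rw [← hEeq]
      by_contra hlt
      push Not at hlt
      -- `2^u ≤ N · 2^E < 2^D · 2^E = 2^(D+E)` with `D + E ≤ u - 1`… contradiction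
      have h1 : 2 ^ u ≤ terms.length * 2 ^ (min (Y ∩ varSet g).card (Yᶜ ∩ varSet g).card +
          (As.map fun q => min (Y ∩ q.2).card (Yᶜ ∩ q.2).card).sum) :=
        hrank.trans (Nat.mul_le_mul_left _ hrk)
      have h2 : terms.length < 2 ^ D := lt_of_le_of_lt hN hD
      have h3 : 2 ^ (D + (min (Y ∩ varSet g).card (Yᶜ ∩ varSet g).card +
          (As.map fun q => min (Y ∩ q.2).card (Yᶜ ∩ q.2).card).sum)) ≤ 2 ^ (u - 1) :=
        Nat.pow_le_pow_right (by norm_num) (by omega)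
      rw [pow_add] at h3
      have h4 : 2 ^ (u - 1) < 2 ^ u := Nat.pow_lt_pow_right (by norm_num) (by omega)
      nlinarith
    obtain ⟨hbal, hunc⟩ := AKV.balanced_of_rank_exponent_ge M x y
      (fun X _ => card_le_card inter_subset_right) hcovM hexp
    have hsumM : (M.map x).sum = (varSet g).card + (As.map fun q => q.2.card).sum := by
      simp only [hM, List.map_cons, List.sum_cons, List.map_map, hx]
      rfl
    have h4m : 4 * m ≤ u := by
      have h4 : 4 ≤ 4 ^ ℓ := le_self_pow (by norm_num) (by omega)
      calc 4 * m = m * 4 := by ring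
        _ ≤ m * 4 ^ ℓ := Nat.mul_le_mul_left m h4
        _ ≤ u := hmu
    -- the term is FULL
    have hfullT : As.length = ts.length ∧ ∀ q L, (q, L) ∈ As.zip (lows (2 * u) ts) →
        L + (varSet g).card + (As.map fun q => q.2.card).sum ≤ q.2.card + 2 * u := by
      rcases hdich with h | ⟨t, ht, hrem⟩
      · exact h
      · exfalso
        have hmt : m ≤ t := le_of_mem_geo ht
        omega
    -- cofactor sets are large
    have hlen : As.length = ℓ := by rw [hfullT.1, hts, length_geo]
    have hlarge : ∀ q ∈ As, m ≤ q.2.card := by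
      intro q hq
      -- find the matching annulus bound in the zip
      obtain ⟨i, hi, rfl⟩ := List.getElem_of_mem hq
      have hi' : i < (lows (2 * u) ts).length := by
        have : (As.zip (lows (2 * u) ts)).length = As.length := by
          rw [List.length_zip, hfullT.1]
          -- `lows` preserves length
          have hl : ∀ (p : ℕ) (l : List ℕ), (lows p l).length = l.length := by
            intro p l; induction l generalizing p with
            | nil => rfl
            | cons a l ih => simp [lows, ih]
          rw [hl, min_self]
        have hl : ∀ (p : ℕ) (l : List ℕ), (lows p l).length = l.length := by
          intro p l; induction l generalizing p with
          | nil => rfl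
          | cons a l ih => simp [lows, ih]
        rw [hl, ← hfullT.1]; exact hi
      have hmem : (As[i], (lows (2 * u) ts)[i]) ∈ As.zip (lows (2 * u) ts) := by
        have := List.getElem_zip (l := As) (l' := lows (2 * u) ts) (i := i)
          (h := by rw [List.length_zip]; exact lt_min hi hi')
        rw [← this]; exact List.getElem_mem _
      have hb := hfullT.2 _ _ hmem
      have hL := le_of_mem_lows_geo (List.getElem_mem hi' : (lows (2 * u) ts)[i] ∈ lows (2 * u) ts)
      rcases hL with hL | hL
      · -- first level: `L = 2u - 2 m 4^{ℓ-1} ≥ u`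
        have h4 : 2 * (m * 4 ^ (ℓ - 1)) ≤ u := by
          have : m * 4 ^ (ℓ - 1) * 4 = m * 4 ^ ℓ := by
            rw [mul_assoc, ← pow_succ, Nat.sub_add_cancel (by omega : 1 ≤ ℓ)]
          omega
        omega
      · omega
    -- conclude: `Y ∈ Bad (g, As)`
    rw [mem_biUnion]
    refine ⟨(g, As), List.mem_toFinset.2 hT, ?_⟩
    simp only [Bad, mem_filter]
    refine ⟨hY, fun q hq => ?_, hlen, hlarge⟩
    have := hbal q.2 (List.mem_cons.2 (Or.inr (List.mem_map.2 ⟨q, hq, rfl⟩)))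
    exact abs_sub_half_le this
  -- (2) each bad set is small
  have hρ0 : (0 : ℝ) ≤ (2 * D + 1 : ℝ) / Real.sqrt ((m : ℝ) + 1) := by positivity
  have hBad : ∀ T ∈ terms.toFinset, ((Bad T).card : ℝ) ≤
      2 * u * (2 * u).choose u * ((2 * D + 1 : ℝ) / Real.sqrt ((m : ℝ) + 1)) ^ ℓ := by
    intro T _
    by_cases hT : T.2.length = ℓ ∧ ∀ q ∈ T.2, m ≤ q.2.card
    · -- compare with the cut-counting bound for the family of cofactor sets of `T`
      have hsub : Bad T ⊆ (univ.powersetCard u).filter fun Y =>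
          ∀ j ∈ (univ : Finset (Fin T.2.length)),
            |(((Y ∩ (T.2[j]).2).card : ℕ) : ℝ) - ((((T.2[j]).2.card : ℕ) : ℝ) / 2)| ≤ D := by
        intro Y hY
        simp only [Bad, mem_filter] at hY
        rw [mem_filter]
        exact ⟨hY.1, fun j _ => hY.2.1 _ (List.getElem_mem _)⟩
      have hu2 : Fintype.card (Fin (2 * u)) = 2 * u := Fintype.card_fin _
      -- pairwise disjointness of the indexed family, from the spec of ANY member? we need it for `T`:
      -- it holds for every term of `decompIter` (decompIter_spec), and `T ∈ terms`.
      obtain ⟨g, As⟩ := T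
      have hTmem : (g, As) ∈ decompIter ts e := by
        rwa [List.mem_toFinset] at *
      obtain ⟨-, -, hpw, -, -⟩ := decompIter_spec ts (2 * u) hadm he hhead hcardE.ge hTmem
      have hdisj : ((univ : Finset (Fin As.length)) : Set (Fin As.length)).PairwiseDisjoint
          (fun j => (As[j]).2) := by
        intro i _ j _ hij
        have hp := List.pairwise_iff_getElem.1 hpw
        rcases lt_or_gt_of_ne (Fin.val_ne_of_ne hij) with h | h
        · have := hp i j (by simp) (by simp) h
          simpa using this
        · have := hp j i (by simp) (by simp) h
          simpa using this.symm
      have hcnt := RazCut.card_balanced_windows_le (α := Fin (2 * u)) hu hu2 univ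
        (fun j : Fin As.length => (As[j]).2) hdisj (fun j => (((As[j]).2.card : ℕ) : ℝ) / 2) D
      have hprod : ∏ j ∈ (univ : Finset (Fin As.length)),
          ((2 * D + 1 : ℝ) / Real.sqrt (((As[j]).2.card : ℝ) + 1)) ≤
            ((2 * D + 1 : ℝ) / Real.sqrt ((m : ℝ) + 1)) ^ ℓ := by
        calc ∏ j ∈ (univ : Finset (Fin As.length)),
              ((2 * D + 1 : ℝ) / Real.sqrt (((As[j]).2.card : ℝ) + 1))
            ≤ ∏ _j ∈ (univ : Finset (Fin As.length)), ((2 * D + 1 : ℝ) / Real.sqrt ((m : ℝ) + 1)) := by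
              refine prod_le_prod (fun j _ => by positivity) fun j _ => ?_
              have hmj : (m : ℝ) + 1 ≤ ((As[j]).2.card : ℝ) + 1 := by
                exact_mod_cast Nat.add_le_add_right (hT.2 _ (List.getElem_mem _)) 1
              exact div_le_div_of_nonneg_left (by positivity) (Real.sqrt_pos.2 (by positivity))
                (Real.sqrt_le_sqrt hmj)
          _ = ((2 * D + 1 : ℝ) / Real.sqrt ((m : ℝ) + 1)) ^ ℓ := by
              rw [prod_const, card_univ, Fintype.card_fin, hT.1]
      calc ((Bad (g, As)).card : ℝ) ≤ _ := by exact_mod_cast card_le_card hsub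
        _ ≤ _ := hcnt
        _ ≤ _ := mul_le_mul_of_nonneg_left hprod (by positivity)
    · have : Bad T = ∅ := by
        simp only [Bad, filter_eq_empty_iff]
        intro Y _ h
        exact hT ⟨h.2.1, h.2.2⟩
      rw [this, card_empty, Nat.cast_zero]
      positivity
  -- (3) count
  have hC : ((2 * u).choose u : ℝ) ≤ terms.length *
      (2 * u * (2 * u).choose u * ((2 * D + 1 : ℝ) / Real.sqrt ((m : ℝ) + 1)) ^ ℓ) := by
    have h1 : (univ.powersetCard u : Finset (Finset (Fin (2 * u)))).card = (2 * u).choose u := by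
      rw [card_powersetCard, card_univ, Fintype.card_fin]
    calc ((2 * u).choose u : ℝ) = ((univ.powersetCard u : Finset (Finset (Fin (2 * u)))).card : ℝ) := by
          rw [h1]
      _ ≤ ((terms.toFinset.biUnion Bad).card : ℝ) := by exact_mod_cast card_le_card hcover
      _ ≤ ∑ T ∈ terms.toFinset, ((Bad T).card : ℝ) := by exact_mod_cast card_biUnion_le
      _ ≤ ∑ _T ∈ terms.toFinset, 2 * u * (2 * u).choose u * ((2 * D + 1 : ℝ) / Real.sqrt ((m : ℝ) + 1)) ^ ℓ :=
          sum_le_sum hBad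
      _ = terms.toFinset.card * _ := by rw [sum_const, nsmul_eq_mul]
      _ ≤ terms.length * _ := by
          gcongr
          exact_mod_cast List.toFinset_card_le terms
  -- (4) the final contradiction
  have hchoose : (0 : ℝ) < (2 * u).choose u := by exact_mod_cast Nat.choose_pos (by omega)
  have hden : (Real.sqrt ((m : ℝ) + 1)) ^ ℓ = ((m : ℝ) + 1) ^ (b + 2) := by
    rw [hℓ, pow_mul, Real.sq_sqrt (by positivity)]
  have hsq : ((2 * D + 1 : ℝ) / Real.sqrt ((m : ℝ) + 1)) ^ ℓ = (2 * D + 1 : ℝ) ^ ℓ / ((m : ℝ) + 1) ^ (b + 2) := by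
    rw [div_pow, hden]
  rw [hsq] at hC
  have hm1 : (0 : ℝ) < ((m : ℝ) + 1) ^ (b + 2) := by positivity
  have hN' : (terms.length : ℝ) ≤ (e.size + 1 : ℕ) := by exact_mod_cast hN
  -- `C ≤ N · 2u · C · (2D+1)^ℓ / (m+1)^(b+2)` ⇒ `(m+1)^(b+2) ≤ N 2u (2D+1)^ℓ`
  have key : ((m : ℝ) + 1) ^ (b + 2) ≤ terms.length * (2 * u) * (2 * D + 1 : ℝ) ^ ℓ := by
    have := hC
    rw [show (terms.length : ℝ) * (2 * u * (2 * u).choose u * ((2 * D + 1 : ℝ) ^ ℓ / ((m : ℝ) + 1) ^ (b + 2)))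
        = (terms.length * (2 * u) * (2 * D + 1 : ℝ) ^ ℓ) * (2 * u).choose u / ((m : ℝ) + 1) ^ (b + 2) by ring] at this
    rw [le_div_iff₀ hm1] at this
    nlinarith
  have : ((m : ℝ) + 1) ^ (b + 2) ≤ ((e.size + 1 : ℕ) : ℝ) * (2 * u) * (2 * D + 1 : ℝ) ^ ℓ := by
    refine key.trans ?_
    gcongr
  linarith

/-! ### Asymptotics: polynomial versus exponential -/

/-- `C (a λ + c)^k ≤ 2^λ` for all large `λ`. [folklore] -/
private theorem exists_poly_le_two_pow (C a c k : ℕ) :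
    ∃ l₀ : ℕ, ∀ l : ℕ, l₀ ≤ l → C * (a * l + c) ^ k ≤ 2 ^ l := by
  -- `λ^k / 2^λ → 0`
  have ht := tendsto_pow_const_div_const_pow_of_one_lt k (show (1 : ℝ) < 2 by norm_num)
  set B : ℝ := (C : ℝ) * ((a : ℝ) + c) ^ k + 1 with hB
  have hBpos : 0 < B := by positivity
  have hev := ht.eventually (gt_mem_nhds (show (0 : ℝ) < 1 / B by positivity))
  obtain ⟨N, hN⟩ := Filter.eventually_atTop.1 hev
  refine ⟨max N 1, fun l hl => ?_⟩
  have hl1 : 1 ≤ l := le_trans (le_max_right _ _) hl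
  have hlt := hN l (le_trans (le_max_left _ _) hl)
  have h2pos : (0 : ℝ) < (2 : ℝ) ^ l := by positivity
  rw [div_lt_div_iff₀ h2pos hBpos, one_mul] at hlt
  -- `(a l + c)^k ≤ ((a + c) l)^k`
  have hmono : ((a : ℝ) * l + c) ^ k ≤ (((a : ℝ) + c) * l) ^ k := by
    have : (c : ℝ) ≤ c * l := le_mul_of_one_le_right (by positivity) (by exact_mod_cast hl1)
    exact pow_le_pow_left₀ (by positivity) (by nlinarith) k
  have key : (C : ℝ) * ((a : ℝ) * l + c) ^ k ≤ (2 : ℝ) ^ l := by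
    calc (C : ℝ) * ((a : ℝ) * l + c) ^ k ≤ C * ((((a : ℝ) + c) * l) ^ k) :=
          mul_le_mul_of_nonneg_left hmono (by positivity)
      _ = (C * ((a : ℝ) + c) ^ k) * (l : ℝ) ^ k := by rw [mul_pow]; ring
      _ ≤ B * (l : ℝ) ^ k := mul_le_mul_of_nonneg_right (by rw [hB]; linarith) (by positivity)
      _ ≤ (2 : ℝ) ^ l := by rw [mul_comm]; exact hlt.le
  exact_mod_cast key

/-- `log₂ (u^b + 1) ≤ b (log₂ u + 1) + 1`. [folklore] -/
private theorem log_pow_succ_le (u b : ℕ) :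
    Nat.log 2 (u ^ b + 1) ≤ b * (Nat.log 2 u + 1) + 1 := by
  have hlt : u < 2 ^ (Nat.log 2 u + 1) := Nat.lt_pow_succ_log_self one_lt_two u
  have h0 : u ^ b ≤ (2 ^ (Nat.log 2 u + 1)) ^ b := Nat.pow_le_pow_left hlt.le b
  have h1 : u ^ b + 1 ≤ 2 ^ (b * (Nat.log 2 u + 1) + 1) := by
    rw [← pow_mul, mul_comm] at h0
    have : 1 ≤ 2 ^ (b * (Nat.log 2 u + 1)) := Nat.one_le_two_pow
    rw [pow_succ]; omega
  calc Nat.log 2 (u ^ b + 1) ≤ Nat.log 2 (2 ^ (b * (Nat.log 2 u + 1) + 1)) := Nat.log_mono_right h1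
    _ = b * (Nat.log 2 u + 1) + 1 := Nat.log_pow one_lt_two _

/-- **Raz 2006, Cor. 3.6 (polynomial form): syntactically multilinear formulas of polynomial
size do not compute full-rank polynomials.**  For every `b` there is `n₀` such that for all
`u ≥ n₀`, every syntactically multilinear formula `Φ` (tree `WExpr`) with `|Φ| ≤ u^b` over the `2u`
variables computes a polynomial that is NOT of full rank: some balanced partition has
`rank M_{Φ^A} < 2^u`.  (Printed: multilinear formulas for full-rank polynomials have size
`n^{Ω(log n)}`; the reduction from multilinear to syntactically multilinear formulas is
[Raz2006, Prop. 2.1].) [cite: Raz2006, Cor. 3.6] -/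
theorem not_isFullRank_of_syntMultilinear (b : ℕ) :
    ∃ n₀ : ℕ, ∀ u : ℕ, n₀ ≤ u → ∀ e : WExpr K (Fin (2 * u)),
      IsSyntMultilinear e → e.size ≤ u ^ b → ¬ IsFullRank u e.eval := by
  set ℓ := 2 * (b + 2) with hℓ
  -- the two polynomial-vs-exponential conditions
  obtain ⟨l₁, hl₁⟩ := exists_poly_le_two_pow (4 ^ ℓ) (2 * b) (2 * b + 5) 1
  obtain ⟨l₂, hl₂⟩ := exists_poly_le_two_pow (4 ^ (ℓ * (b + 2) + 1)) (2 * b) (2 * b + 5) ℓ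
  refine ⟨2 ^ (max (max l₁ l₂) (2 * ℓ + 1)), fun u hu e he hsize => ?_⟩
  set lam := Nat.log 2 u with hlam
  have hu1 : 1 ≤ u := le_trans Nat.one_le_two_pow hu
  have hlam_ge : max (max l₁ l₂) (2 * ℓ + 1) ≤ lam := Nat.le_log_of_pow_le one_lt_two hu
  have h2lam : 2 ^ lam ≤ u := Nat.pow_log_le_self 2 (by omega)
  -- `m = u / 4^ℓ ≥ 1`
  set m := u / 4 ^ ℓ with hm
  have h4pos : 0 < 4 ^ ℓ := by positivity
  have hmu : m * 4 ^ ℓ ≤ u := Nat.div_mul_le_self u _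
  have h4ℓ : 4 ^ ℓ ≤ 2 ^ lam := by
    rw [show (4 : ℕ) = 2 ^ 2 by norm_num, ← pow_mul]
    exact Nat.pow_le_pow_right (by norm_num) (by omega)
  have hm1 : 1 ≤ m := by
    rw [hm, Nat.le_div_iff_mul_le h4pos, one_mul]; exact h4ℓ.trans h2lam
  -- `D`
  set D := Nat.log 2 (u ^ b + 1) + 1 with hDdef
  have hD : e.size + 1 < 2 ^ D :=
    lt_of_le_of_lt (Nat.add_le_add_right hsize 1) (Nat.lt_pow_succ_log_self one_lt_two _)
  have hDle : 2 * D + 1 ≤ 2 * b * lam + (2 * b + 5) := by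
    have := log_pow_succ_le u b
    rw [hDdef]; nlinarith
  -- condition (iv): `2D + 1 ≤ m`
  have hmD : 2 * D + 1 ≤ m := by
    rw [hm, Nat.le_div_iff_mul_le h4pos]
    have h1 := hl₁ lam (le_trans (le_trans (le_max_left _ _) (le_max_left _ _)) hlam_ge)
    rw [pow_one] at h1
    calc (2 * D + 1) * 4 ^ ℓ ≤ (2 * b * lam + (2 * b + 5)) * 4 ^ ℓ := Nat.mul_le_mul_right _ hDle
      _ = 4 ^ ℓ * (2 * b * lam + (2 * b + 5)) := by ring
      _ ≤ 2 ^ lam := h1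
      _ ≤ u := h2lam
  -- condition (v): the final inequality, in `ℝ`
  have h2 := hl₂ lam (le_trans (le_trans (le_max_right _ _) (le_max_left _ _)) hlam_ge)
  have hP : 4 ^ (ℓ * (b + 2) + 1) * (2 * D + 1) ^ ℓ ≤ u :=
    le_trans (le_trans (Nat.mul_le_mul_left _ (Nat.pow_le_pow_left hDle ℓ)) h2) h2lam
  have hfinal : ((e.size + 1 : ℕ) : ℝ) * (2 * u) * (2 * D + 1) ^ ℓ < ((m : ℝ) + 1) ^ (b + 2) := by
    have hsz : ((e.size + 1 : ℕ) : ℝ) ≤ 2 * (u : ℝ) ^ b := by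
      have : e.size + 1 ≤ 2 * u ^ b := by
        have : 1 ≤ u ^ b := Nat.one_le_pow _ _ hu1
        omega
      exact_mod_cast this
    have hPR : (4 : ℝ) ^ (ℓ * (b + 2) + 1) * (2 * D + 1 : ℝ) ^ ℓ ≤ u := by exact_mod_cast hP
    -- `(m+1) 4^ℓ > u`
    have hm' : (u : ℝ) < ((m : ℝ) + 1) * 4 ^ ℓ := by
      have := Nat.lt_mul_div_succ u h4pos
      have : (u : ℝ) < ((4 ^ ℓ * (u / 4 ^ ℓ + 1) : ℕ) : ℝ) := by exact_mod_cast this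
      rw [hm]; push_cast at this ⊢; linarith
    have hupos : (0 : ℝ) < u := by exact_mod_cast hu1
    have h4R : (0 : ℝ) < (4 : ℝ) ^ ℓ := by positivity
    -- `(u / 4^ℓ)^(b+2) < (m+1)^(b+2)`
    have hpow : ((u : ℝ) / 4 ^ ℓ) ^ (b + 2) < ((m : ℝ) + 1) ^ (b + 2) := by
      refine pow_lt_pow_left₀ ?_ (by positivity) (by omega)
      rw [div_lt_iff₀ h4R]; exact hm'
    -- `LHS ≤ 4 u^{b+1} (2D+1)^ℓ ≤ u^{b+2} / 4^{ℓ(b+2)} = (u/4^ℓ)^{b+2}`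
    have hchain : ((e.size + 1 : ℕ) : ℝ) * (2 * u) * (2 * D + 1) ^ ℓ ≤ ((u : ℝ) / 4 ^ ℓ) ^ (b + 2) := by
      rw [div_pow, ← pow_mul, le_div_iff₀ (by positivity)]
      calc ((e.size + 1 : ℕ) : ℝ) * (2 * u) * (2 * D + 1) ^ ℓ * 4 ^ (ℓ * (b + 2))
          ≤ (2 * (u : ℝ) ^ b) * (2 * u) * (2 * D + 1) ^ ℓ * 4 ^ (ℓ * (b + 2)) := by gcongr
        _ = (u : ℝ) ^ (b + 1) * (4 ^ (ℓ * (b + 2) + 1) * (2 * D + 1 : ℝ) ^ ℓ) := by ring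
        _ ≤ (u : ℝ) ^ (b + 1) * u := mul_le_mul_of_nonneg_left hPR (by positivity)
        _ = (u : ℝ) ^ (b + 2) := by ring
    exact lt_of_le_of_lt hchain hpow
  exact not_isFullRank_of_syntMultilinear_core hm1 hmu he hD hmD hfinal

end Literature.Barriers.ValiantsHypothesis.RazFormula
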